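import Summits.ABC.StewartYu.PadicG3OrdLine
import HarnessLib

/-!
# Cell abc-stewartyu, WP-L.P(odd) (crux r3 `PadicCoreOddRat`, stmt-ABC-20503): the `Λ`-ORDER LINE of the saturated frame from the negated bound
# (directions `b̃ = b ᵥ* C` of size `Wb ≤ 4ⁿ·(W + log 2Vmax)`, bound at the DATUM's `W`)

`Summits/ABC/StewartYu/PadicG3SatOrdLine.lean` — cell `abc-stewartyu` (seat p2-g6; pack twin, `Λ`-line; R31(a): the negated bound is at the datum's `W`,
the direction sizes live in a separate letter `Wb`).  Proofs only; no definition, no named fact.  Twin of `PadicG3OrdLine.ordLine_of_negBound` (p2-g4)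
with the direction size decoupled from the bound's `W`:

* `ordLine_of_negBound_sat`: `c ≥ 256`, `log max(3,|bⱼ|) ≤ Wb`, `Wb ≤ 4ⁿ·(W + log(2Vmax))`, and
  `¬ (ord_p(∏αⱼ^{bⱼ} − 1)·log p ≤ cⁿ·(p/log p)·∏V·(W + log p + log 2Vmax))` ⇒ `∏αⱼ^{bⱼ} ≠ 1` and `(m+1) + ord_p(b_{j₀}) ≤ ord_p(∏αⱼ^{bⱼ} − 1)`;
* `log_max_three_vecMul_le`: for `b̃ = bo ᵥ* C` with `|C_jk| ≤ M` (`1 ≤ M`) and `log max(3,|boⱼ|) ≤ W`: `log max(3,|b̃ₖ|) ≤ log(n·M) + W`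
  (how the frame produces `Wb`).

References: K. Yu, Acta Math. 211 (2013) §7; Yu. V. Nesterenko, LNM 1819 (2003) §5.
-/

noncomputable section

open Finset Matrix

namespace Summit.ABC.StewartYu

namespace G3Setup

variable {p : ℕ} [Fact p.Prime] (S : G3Setup p)

/-- **The `Λ`-order line of the saturated frame**: as `ordLine_of_negBound`, with the direction size `Wb ≤ 4ⁿ(W + log 2Vmax)` decoupled from
the bound's `W`. [cite: Yu2013, §7; shape only] -/
theorem ordLine_of_negBound_sat (hp2 : p ≠ 2) (hn2 : 2 ≤ S.n) (V : Fin S.n → ℝ) (Vmax W Wb : ℝ)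
    (hV1 : ∀ j, 1 ≤ V j) (hVm : ∀ j, V j ≤ Vmax) (hWb : ∀ j, Real.log (max 3 (|S.b j| : ℝ)) ≤ Wb) (hW : 1 ≤ W)
    (hWbR : Wb ≤ 4 ^ S.n * (W + Real.log (2 * Vmax)))
    {c : ℝ} (hc : 256 ≤ c)
    (hU : ¬ (padicValRat p (∏ j, S.α j ^ S.b j - 1) : ℝ) * Real.log p ≤
        c ^ S.n * ((p : ℝ) / Real.log p) * (∏ j, V j) * (W + Real.log p + Real.log (2 * Vmax)))
    (P : PadicG3Par S.n) (hPp : P.p = p) :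
    ∏ j, S.α j ^ S.b j ≠ 1 ∧ ((P.m + 1 : ℕ) : ℤ) + padicValInt p (S.b S.j₀) ≤ padicValRat p (∏ j, S.α j ^ S.b j - 1) := by
  have _h2 := hp2
  have hp : p.Prime := Fact.out
  have hp3 : 3 ≤ p := by have := hp.two_le; omega
  have hpR : (3 : ℝ) ≤ p := by exact_mod_cast hp3
  have hlogp : 0 < Real.log p := Real.log_pos (by linarith)
  have hlogp1 : 1 ≤ Real.log p := by
    rw [← Real.log_exp 1]
    exact Real.log_le_log (Real.exp_pos 1) (le_trans (le_of_lt (by have := Real.exp_one_lt_d9; linarith)) hpR)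
  have hn1 : 1 ≤ S.n := by omega
  have hVmax : 1 ≤ Vmax := le_trans (hV1 ⟨0, hn1⟩) (hVm ⟨0, hn1⟩)
  have hprodV : 1 ≤ ∏ j, V j := by
    calc (1 : ℝ) = ∏ _j : Fin S.n, (1 : ℝ) := by simp
      _ ≤ ∏ j, V j := prod_le_prod (fun _ _ => zero_le_one) fun j _ => hV1 j
  have hlog2V : Real.log 2 ≤ Real.log (2 * Vmax) := Real.log_le_log (by norm_num) (by linarith)
  have hl2 : (1 : ℝ) / 2 < Real.log 2 := by have := Real.log_two_gt_d9; linarith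
  have hlog2V0 : 0 ≤ Real.log (2 * Vmax) := by linarith
  have hpl : 1 ≤ (p : ℝ) / Real.log p := by
    rw [le_div_iff₀ hlogp, one_mul]
    have := Real.log_le_sub_one_of_pos (show (0 : ℝ) < p by linarith)
    linarith
  set R : ℝ := c ^ S.n * ((p : ℝ) / Real.log p) * (∏ j, V j) * (W + Real.log p + Real.log (2 * Vmax)) with hR
  have hc0 : (0 : ℝ) ≤ c := le_trans (by norm_num) hc
  have hWl : 0 ≤ W + Real.log p + Real.log (2 * Vmax) := by linarith
  have hR1 : c ^ S.n * (W + Real.log p + Real.log (2 * Vmax)) ≤ R := by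
    have h256 : (0 : ℝ) ≤ c ^ S.n := by positivity
    calc c ^ S.n * (W + Real.log p + Real.log (2 * Vmax)) = c ^ S.n * 1 * 1 * (W + Real.log p + Real.log (2 * Vmax)) := by ring
      _ ≤ R := by
        rw [hR]
        exact mul_le_mul_of_nonneg_right (mul_le_mul (mul_le_mul_of_nonneg_left hpl h256) hprodV zero_le_one (by positivity)) hWl
  -- `cⁿ ≥ 4ⁿ + 8n + 9`: `Wb + 2 log p + 8(n+1) ≤ R`
  have hR2 : Wb + 2 * Real.log p + 8 * (S.n + 1) ≤ R := by
    have h' := Summit.ABC.ABC.Cruxes.Y07Odd.SlabOdd.eight_mul_add_nine_le_pow hn1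
    have hcn : (256 : ℝ) ^ S.n ≤ c ^ S.n := pow_le_pow_left₀ (by norm_num) hc _
    have h4 : (4 : ℝ) ^ S.n * 64 ^ S.n = 256 ^ S.n := by rw [← mul_pow]; norm_num
    have h64 : (64 : ℝ) ≤ 64 ^ S.n := le_self_pow₀ (by norm_num) (by omega)
    have hbern : (1 : ℝ) + S.n * 3 ≤ 4 ^ S.n := by
      have := one_add_mul_le_pow (show (-2 : ℝ) ≤ 3 by norm_num) S.n
      norm_num at this ⊢; linarith
    have h40 : (0 : ℝ) ≤ 4 ^ S.n := by positivity
    -- `cⁿ ≥ 256ⁿ = 4ⁿ·64ⁿ ≥ 64·4ⁿ ≥ 4ⁿ + 63(1 + 3n) ≥ 4ⁿ + 8n + 11`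
    have hgap : (4 : ℝ) ^ S.n + (8 * S.n + 9 + 2) ≤ c ^ S.n := by
      nlinarith [mul_le_mul_of_nonneg_left h64 h40]
    have hA : (4 : ℝ) ^ S.n * (W + Real.log (2 * Vmax)) ≤ 4 ^ S.n * (W + Real.log p + Real.log (2 * Vmax)) := by
      refine mul_le_mul_of_nonneg_left (by linarith) (by positivity)
    have hB : ((8 : ℝ) * S.n + 9 + 2) * 1 ≤ (8 * S.n + 9 + 2) * (W + Real.log p + Real.log (2 * Vmax)) :=
      mul_le_mul_of_nonneg_left (by linarith) (by positivity)
    have hsplit : (4 : ℝ) ^ S.n * (W + Real.log p + Real.log (2 * Vmax)) + (8 * S.n + 9 + 2) * (W + Real.log p + Real.log (2 * Vmax)) ≤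
        c ^ S.n * (W + Real.log p + Real.log (2 * Vmax)) := by
      rw [← add_mul]; exact mul_le_mul_of_nonneg_right hgap hWl
    have hlogp3 : Real.log p ≤ (8 * S.n + 9 + 2) / 2 * Real.log p := by
      have : (1 : ℝ) ≤ (8 * S.n + 9 + 2) / 2 := by
        have : (0 : ℝ) ≤ S.n := Nat.cast_nonneg _; linarith
      exact le_mul_of_one_le_left hlogp.le this
    nlinarith [hsplit, hA, hB, hR1, hWbR]
  have hRpos : 0 < R := by
    have h0 : 0 ≤ Wb := le_trans (Real.log_nonneg (le_trans (by norm_num) (le_max_left _ _))) (hWb ⟨0, hn1⟩)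
    have : (0 : ℝ) ≤ S.n := Nat.cast_nonneg _
    linarith
  -- the order `U`
  set U : ℤ := padicValRat p (∏ j, S.α j ^ S.b j - 1) with hUdef
  have hUlt : R < (U : ℝ) * Real.log p := by push Not at hU; rw [hR]; exact hU
  refine ⟨?_, ?_⟩
  · intro h1
    have hU0 : U = 0 := by rw [hUdef, h1, sub_self, padicValRat.zero]
    rw [hU0] at hUlt; push_cast at hUlt; rw [zero_mul] at hUlt
    exact absurd hUlt (not_lt.mpr hRpos.le)
  · -- `ord_p(b_{j₀}) log p ≤ Wb`
    set v : ℕ := padicValInt p (S.b S.j₀) with hvdef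
    have hv : (v : ℝ) * Real.log p ≤ Wb := by
      have hb0 : S.b S.j₀ ≠ 0 := S.bj₀_ne
      have hdvd : p ^ v ∣ (S.b S.j₀).natAbs := by rw [hvdef]; unfold padicValInt; exact pow_padicValNat_dvd
      have hle : p ^ v ≤ (S.b S.j₀).natAbs := Nat.le_of_dvd (Int.natAbs_pos.mpr hb0) hdvd
      have hleR : (p : ℝ) ^ v ≤ |(S.b S.j₀ : ℝ)| := by
        rw [← Int.cast_abs, ← Nat.cast_natAbs]; exact_mod_cast hle
      have hpv : (0 : ℝ) < (p : ℝ) ^ v := by positivity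
      calc (v : ℝ) * Real.log p = Real.log ((p : ℝ) ^ v) := by rw [Real.log_pow]
        _ ≤ Real.log |(S.b S.j₀ : ℝ)| := Real.log_le_log hpv hleR
        _ ≤ Real.log (max 3 (|S.b S.j₀| : ℝ)) := by
            rw [← Int.cast_abs]
            refine Real.log_le_log (by rw [Int.cast_abs]; exact lt_of_lt_of_le hpv hleR) ?_
            push_cast; exact le_max_right _ _
        _ ≤ Wb := hWb S.j₀
    -- `(m+1) log p ≤ 8(n+1) + 2 log p`
    have hm : ((P.m + 1 : ℕ) : ℝ) * Real.log p ≤ 8 * (S.n + 1) + 2 * Real.log p := by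
      have h := P.m_le
      rw [hPp] at h
      unfold Summit.ABC.StewartYu.PadicG3Par.cG at h
      push_cast
      have : (P.m : ℝ) * Real.log p ≤ 8 * (S.n + 1) + Real.log p := by
        have := mul_le_mul_of_nonneg_right h hlogp.le
        rw [add_mul, div_mul_cancel₀ _ hlogp.ne', one_mul] at this
        linarith
      nlinarith
    -- compare
    have hk : (((P.m + 1 : ℕ) : ℤ) + (v : ℤ) : ℝ) * Real.log p < (U : ℝ) * Real.log p := by
      push_cast
      have : (((P.m + 1 : ℕ) : ℝ) + v) * Real.log p ≤ R := by
        rw [add_mul]; push_cast at hm ⊢; linarith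
      push_cast at this
      linarith
    have hk' : (((P.m + 1 : ℕ) : ℤ) + (v : ℤ) : ℝ) < (U : ℝ) := lt_of_mul_lt_mul_right hk hlogp.le
    have hk'' : ((P.m + 1 : ℕ) : ℤ) + (v : ℤ) < U := by exact_mod_cast hk'
    rw [hvdef] at hk''
    exact hk''.le

/-- **The direction sizes of the saturated frame**: for `b̃ = bo ᵥ* C` with `|C_jk| ≤ M`, `1 ≤ M`, and `log max(3,|boⱼ|) ≤ W` (`n ≥ 1`):
`log max(3, |b̃ₖ|) ≤ log(n·M) + W`. [folklore] -/
theorem log_max_three_vecMul_le {n : ℕ} (hn : 1 ≤ n) (bo : Fin n → ℤ) (C : Matrix (Fin n) (Fin n) ℤ) {M : ℕ} (hM : 1 ≤ M)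
    (hC : ∀ j k, |C j k| ≤ (M : ℤ)) {W : ℝ} (hW : ∀ j, Real.log (max 3 (|bo j| : ℝ)) ≤ W) (k : Fin n) :
    Real.log (max 3 (|(bo ᵥ* C) k| : ℝ)) ≤ Real.log ((n : ℝ) * M) + W := by
  have hn' : (1 : ℝ) ≤ n := by exact_mod_cast hn
  have hM' : (1 : ℝ) ≤ M := by exact_mod_cast hM
  have hW3 : Real.log 3 ≤ W := le_trans (Real.log_le_log (by norm_num) (le_max_left _ _)) (hW ⟨0, hn⟩)
  have hexpW : ∀ j, (|(bo j : ℝ)|) ≤ Real.exp W := by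
    intro j
    have h1 : (max 3 (|bo j| : ℝ)) ≤ Real.exp W := by
      have hpos : (0 : ℝ) < max 3 (|bo j| : ℝ) := lt_of_lt_of_le (by norm_num) (le_max_left _ _)
      rw [← Real.exp_log hpos]; exact Real.exp_le_exp.mpr (hW j)
    have : (|(bo j : ℝ)|) ≤ max 3 (|bo j| : ℝ) := by rw [← Int.cast_abs]; exact le_max_right _ _
    exact this.trans h1
  have h3W : (3 : ℝ) ≤ Real.exp W := by
    calc (3 : ℝ) = Real.exp (Real.log 3) := (Real.exp_log (by norm_num)).symm
      _ ≤ Real.exp W := Real.exp_le_exp.mpr hW3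
  -- `|b̃ₖ| ≤ n·M·e^W`
  have hbt : (|((bo ᵥ* C) k : ℤ)| : ℝ) ≤ n * M * Real.exp W := by
    rw [Matrix.vecMul, dotProduct]
    push_cast
    calc |∑ j, (bo j : ℝ) * (C j k : ℝ)| ≤ ∑ j, |(bo j : ℝ) * (C j k : ℝ)| := abs_sum_le_sum_abs _ _
      _ ≤ ∑ _j : Fin n, Real.exp W * M := by
          refine sum_le_sum fun j _ => ?_
          rw [abs_mul]
          have hCj : |(C j k : ℝ)| ≤ M := by
            have := hC j k
            rw [← Int.cast_abs]; exact_mod_cast this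
          exact mul_le_mul (hexpW j) hCj (abs_nonneg _) (Real.exp_pos W).le
      _ = n * M * Real.exp W := by rw [sum_const, card_univ, Fintype.card_fin, nsmul_eq_mul]; ring
  have hmax : (max 3 (|(bo ᵥ* C) k| : ℝ)) ≤ n * M * Real.exp W := by
    refine max_le ?_ ?_
    · calc (3 : ℝ) = 1 * 1 * 3 := by ring
        _ ≤ n * M * Real.exp W := mul_le_mul (mul_le_mul hn' hM' zero_le_one (by linarith)) h3W (by norm_num) (by positivity)
    · exact hbt
  have hpos : (0 : ℝ) < max 3 (|(bo ᵥ* C) k| : ℝ) := lt_of_lt_of_le (by norm_num) (le_max_left _ _)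
  calc Real.log (max 3 (|(bo ᵥ* C) k| : ℝ)) ≤ Real.log (n * M * Real.exp W) := Real.log_le_log hpos hmax
    _ = Real.log ((n : ℝ) * M) + W := by rw [Real.log_mul (by positivity) (Real.exp_pos W).ne', Real.log_exp]

end G3Setup

end Summit.ABC.StewartYu

end
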